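import Literature.Geometry.Riemannian.KernelGradientIntegralBoundLocal
import Literature.Geometry.Riemannian.HeatKernelUpperBound
import Literature.Geometry.Riemannian.HeatKernelSemigroupDeriv
import Literature.Geometry.Riemannian.KernelGradientBoundAux
import HarnessLib

/-!
# Bamler's gradient bound for the heat kernel (Bamler 2020a, Thm. 7.5, arXiv v1 Thm. 26)

R. Bamler, *Entropy and heat kernel bounds on a Ricci flow background*, arXiv:2008.07093 (2020a),
§7.1, Thm. 7.5: *"If `[s,t] ⊂ I` and `R ≥ R_min` on `M × [s,t]`, then there are constants
`C(R_min(t−s)), C₀(R_min(t−s)) < ∞` such that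
`|∇ₓK|(x,t;y,s)/K(x,t;y,s) ≤ C (t−s)^{-1/2} √( log ( C₀ exp(−𝒩_{x,t}(t−s)) / ((t−s)^{n/2} K(x,t;y,s)) ) )`."*

Proved here in the directional form used throughout the tree (`exists_abs_deriv_heatKernelFn_le`):
for `m ≥ 3` and `Λ ≥ 0` there are `C, C₀ > 0` depending only on `m, Λ` such that for every Ricci
flow on `[a,T]` of a smooth family of Riemannian metrics on a closed connected manifold modelled
on `ℝᵐ`, all `a < s < t < T` with `R ≥ R_min` on `M × [s,t]`, `−R_min(t−s) ≤ Λ`, every `C^∞`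
curve `γ` with `g_t(γ̇0,γ̇0) ≤ 1` and every `y`, writing `K = K(γ0,t;y,s)`, `𝒩 = 𝒩_{γ0,t}(t−s)`,
`τ = t − s`: `2K ≤ C₀ τ^{-m/2} e^{-𝒩}` (so the logarithm below is `≥ log 2`) and

  `|∂_σ|₀ K(γσ,t;y,s)| ≤ C τ^{-1/2} K √( log( C₀ τ^{-m/2} e^{-𝒩} / K ) )`.

Proof (§7.4 of the source, at general scale — the tree has no parabolic rescaling): with the
midpoint `r = (s+t)/2`, `u = K(·,r;y,s)` and `ν = ν_{x,t;r}` one has `K = ∫ u dν`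
(`heatKernelFn_reproduction`) and `∂K = ∫ (∂K/K) u dν` (`deriv_heatKernelFn_curve_eq_integral_mul`);
`u ≤ C₇ (τ/2)^{-m/2} e^{−𝒩*(·,r)}` by Thm. 7.1 (`exists_heatKernelFn_le_rpow_mul_exp_neg_kernelNashEntropy`)
and `−𝒩*(·,r) ≤ −𝒩*(x,t) + L(√(H τ/2) + d_r(z₁,·))` at an `H_m`-centre `z₁` (Cor. 5.10/Thm. 5.9,
`kernelNashEntropy_sub_le_of_lintegral_edist_sq_le`), whence `∫ u² dν ≤ D₂² τ^{-m} e^{−2𝒩}` by the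
exponential moment bound (`integral_exp_mul_edist_heatKernelMeasure_le`); the score `q = ∂K/K`
obeys the localized Prop. 4.2 (`exists_mul_setIntegral_sq_deriv_heatKernelFn_div_le`), hence a
sub-Gaussian tail, and splitting `∫ q u dν` at the level `λ = √(c_L(1 − log a))`,
`a = (K/(2C₇ τ^{-m/2}e^{-𝒩}))² ≤ 1/4`, with Cauchy–Schwarz on `{q > λ}` gives the claim
(`integral_mul_le_sqrt_mul_of_local_sq_bound`). Constants are explicit but not optimised.

## References

* R. H. Bamler, *Entropy and heat kernel bounds on a Ricci flow background*, arXiv:2008.07093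
  (2020), §7.1 Thm. 7.5 (arXiv v1 Thm. 26) and §7.4 (its proof). [Bamler2020Entropy]
-/

noncomputable section

open Set Filter Function MeasureTheory Measure ProbabilityTheory
open scoped Manifold ContDiff Topology ENNReal NNReal

namespace Literature.Geometry.Riemannian

open Lorentzian Lorentzian.PseudoRiemannianMetric MetricFlow

/-! ### Thm. 7.5, directional form -/

section GradientBound

/-- **Bamler 2020a, Thm. 7.5 (arXiv v1 Thm. 26), directional form.** For every
`m ≥ 3` and `Λ ≥ 0` there are constants `C, C₀ > 0` (depending only on `m`, `Λ`) such that for every Ricci flow `hflow` on `[a,T]` of a smooth family of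
Riemannian metrics on a closed connected manifold modelled on `ℝᵐ`, all `a < s < t < T` with
`R ≥ R_min` on `M × [s,t]` and `−R_min (t − s) ≤ Λ`, every `C^∞` curve `γ` with
`g_t(γ̇0,γ̇0) ≤ 1` and every `y`, writing `K = K(γ0,t;y,s)`, `𝒩 = 𝒩_{γ0,t}(t−s)`, `τ = t − s`:
`2K ≤ C₀ τ^{-m/2} e^{-𝒩}` and

  `|∂_σ|₀ K(γσ,t;y,s)| ≤ C τ^{-1/2} K √( log( C₀ τ^{-m/2} e^{-𝒩} / K ) )`.

Proof (§7.4 at general scale):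
semigroup at the midpoint `r`, `u = K(·,r;y,s)`, `ν = ν_{x,t;r}`, `∂K = ∫ (∂K/K) u dν`; `u` and
`∫ u² dν` bounded by Thm. 7.1, the entropy comparison of Cor. 5.10/Thm. 5.9 at an `H_m`-centre and
the exponential moment bound; split `{∂K/K > λ}` / `{≤ λ}` with `λ² = 2C_loc(1 − log a)/τ`,
`a = (K/(C₀ τ^{-m/2} e^{-𝒩}))²`, using the localized Prop. 4.2 and its sub-Gaussian tail.
[cite: Bamler2020Entropy, §7.1 Thm. 7.5 (arXiv v1 Thm. 26); §7.4] -/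
theorem exists_abs_deriv_heatKernelFn_le (m : ℕ) (hm : 3 ≤ m) {Λ : ℝ} (hΛ : 0 ≤ Λ) :
    ∃ C C₀ : ℝ, 0 < C ∧ 0 < C₀ ∧ ∀ {M : Type*} [TopologicalSpace M]
      [ChartedSpace (EuclideanSpace ℝ (Fin m)) M]
      [IsManifold 𝓘(ℝ, EuclideanSpace ℝ (Fin m)) ∞ M] [T2Space M] [CompactSpace M]
      [SecondCountableTopology M] [MeasurableSpace M] [BorelSpace M] [ConnectedSpace M]
      {h : ℝ → PseudoRiemannianMetric 𝓘(ℝ, EuclideanSpace ℝ (Fin m)) ∞ (EuclideanSpace ℝ (Fin m))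
        (TangentSpace 𝓘(ℝ, EuclideanSpace ℝ (Fin m)) : M → Type _)}
      {cov : ℝ → CovariantDerivative 𝓘(ℝ, EuclideanSpace ℝ (Fin m)) (EuclideanSpace ℝ (Fin m))
        (TangentSpace 𝓘(ℝ, EuclideanSpace ℝ (Fin m)) : M → Type _)}
      {a T : ℝ} (hflow : IsRicciFlow h cov (Icc a T)) (hh : IsContMDiffFamilyOn ∞ h univ)
      (hR : ∀ r, (h r).IsRiemannian),
      ∀ {s t : ℝ}, a < s → s < t → t < T → ∀ {Rmin : ℝ},
      (∀ r ∈ Icc s t, ∀ z : M, Rmin ≤ (h r).scalarCurvatureWith (cov r) z) →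
      -Rmin * (t - s) ≤ Λ →
      ∀ {γ : ℝ → M}, ContMDiff 𝓘(ℝ, ℝ) 𝓘(ℝ, EuclideanSpace ℝ (Fin m)) ∞ γ →
      (h t).val (γ 0) (velocity 𝓘(ℝ, EuclideanSpace ℝ (Fin m)) γ 0)
        (velocity 𝓘(ℝ, EuclideanSpace ℝ (Fin m)) γ 0) ≤ 1 →
      ∀ y : M,
      2 * hflow.heatKernelFn hh hR t (γ 0) (y, s) ≤ C₀ * (t - s) ^ (-(m : ℝ) / 2) *
          Real.exp (-(pointedNashEntropy h
            (fun r' v ↦ hflow.heatKernelFn hh hR t (γ 0) (v, r')) m t s)) ∧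
      |deriv (fun σ ↦ hflow.heatKernelFn hh hR t (γ σ) (y, s)) 0| ≤
        C * (t - s) ^ (-(1 : ℝ) / 2) * hflow.heatKernelFn hh hR t (γ 0) (y, s) *
          Real.sqrt (Real.log (C₀ * (t - s) ^ (-(m : ℝ) / 2) *
            Real.exp (-(pointedNashEntropy h
              (fun r' v ↦ hflow.heatKernelFn hh hR t (γ 0) (v, r')) m t s)) /
            hflow.heatKernelFn hh hR t (γ 0) (y, s))) := by
  classical
  /- ── universal constants ── -/
  set Hm : ℝ := ((m : ℝ) - 1) * Real.pi ^ 2 / 2 + 4 with hHm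
  have hm0 : 0 < m := by omega
  have hHm0 : 0 < Hm := by
    have : 0 ≤ ((m : ℝ) - 1) * Real.pi ^ 2 / 2 := by
      have h1 : (1 : ℝ) ≤ m := by exact_mod_cast hm0
      have := Real.pi_pos; positivity
    rw [hHm]; linarith
  obtain ⟨C₇, hC₇, H7⟩ := exists_heatKernelFn_le_rpow_mul_exp_neg_kernelNashEntropy m hm hΛ
  have hmΛ : 0 ≤ (m : ℝ) + Λ := by positivity
  set E₁ : ℝ := Real.sqrt ((m : ℝ) + Λ) * Real.sqrt Hm with hE₁
  have hE₁0 : 0 ≤ E₁ := by positivity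
  set D₂ : ℝ := C₇ * Real.sqrt (3 * 2 ^ m * Real.exp (4 * E₁ + 16 * ((m : ℝ) + Λ))) with hD₂
  have hD₂0 : 0 ≤ D₂ := by positivity
  obtain ⟨Cloc, hCloc0, HLoc⟩ := exists_mul_setIntegral_sq_deriv_heatKernelFn_div_le
  set B₀ : ℝ := 2 * C₇ with hB₀
  have hB₀0 : 0 < B₀ := by positivity
  set C₀ : ℝ := Real.sqrt (Real.exp 1) * B₀ with hC₀
  have hsqe : 1 ≤ Real.sqrt (Real.exp 1) := by
    rw [Real.le_sqrt (by norm_num) (Real.exp_pos _).le, one_pow]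
    exact Real.one_le_exp zero_le_one
  have hC₀0 : 0 < C₀ := by positivity
  set C : ℝ := 2 * Real.sqrt Cloc * (1 + D₂ / B₀) with hC
  have hCpos : 0 < C := by positivity
  refine ⟨C, C₀, hCpos, hC₀0, ?_⟩
  intro M _ _ _ _ _ _ _ _ _ h cov a T hflow hh hR s t has hst htT Rmin hRmin hRΛ γ hγ h1 y
  /- ── times and basic objects ── -/
  set τ : ℝ := t - s with hτdef
  have hτ : 0 < τ := sub_pos.2 hst
  set r : ℝ := s + τ / 2 with hrdef
  have hsr : s < r := by rw [hrdef]; linarith only [hτ]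
  have hrt : r < t := by
    have : r = t - τ / 2 := by rw [hrdef, hτdef]; ring
    rw [this]; linarith only [hτ]
  have har : a < r := has.trans hsr
  have hrs : r - s = τ / 2 := by rw [hrdef]; ring
  have htr : t - r = τ / 2 := by rw [hrdef, hτdef]; ring
  have ht : t ∈ Ioc a T := ⟨har.trans hrt, htT.le⟩
  have hrT : r ∈ Ioc a T := ⟨har, (hrt.trans htT).le⟩
  have hrI : r ∈ Icc a T := ⟨har.le, (hrt.trans htT).le⟩
  have htI : t ∈ Icc a T := ⟨(har.trans hrt).le, htT.le⟩
  set x : M := γ 0 with hx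
  set K : ℝ := hflow.heatKernelFn hh hR t x (y, s) with hK
  have hKpos : 0 < K := hflow.heatKernelFn_pos hh hR ht x ⟨mem_univ _, has, hst⟩
  set N : ℝ := pointedNashEntropy h (fun r' v ↦ hflow.heatKernelFn hh hR t x (v, r')) m t s with hN
  have hτpow : 0 < τ ^ (-(m : ℝ) / 2) := Real.rpow_pos_of_pos hτ _
  set P : ℝ := τ ^ (-(m : ℝ) / 2) * Real.exp (-N) with hP
  have hP0 : 0 < P := mul_pos hτpow (Real.exp_pos _)
  /- ── Thm. 7.1 on `[s, t]`: `K ≤ C₇ P`; first conjunct ── -/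
  have hK7 : K ≤ C₇ * P := by
    have h' := H7 hflow hh hR has hst htT hRmin hRΛ x y
    calc K = hflow.heatKernelFn hh hR t x (y, s) := rfl
      _ ≤ C₇ * (t - s) ^ (-(m : ℝ) / 2) * Real.exp (-N) := h'
      _ = C₇ * P := by rw [hP, hτdef]; ring
  have hfirst : 2 * K ≤ C₀ * τ ^ (-(m : ℝ) / 2) * Real.exp (-N) := by
    have e : C₀ * τ ^ (-(m : ℝ) / 2) * Real.exp (-N) = Real.sqrt (Real.exp 1) * (B₀ * P) := by
      rw [hC₀, hP]; ring
    rw [e, hB₀]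
    have h0 : 0 ≤ 2 * C₇ * P := mul_nonneg (by positivity) hP0.le
    calc 2 * K ≤ 1 * (2 * C₇ * P) := by linarith only [hK7]
      _ ≤ Real.sqrt (Real.exp 1) * (2 * C₇ * P) := mul_le_mul_of_nonneg_right hsqe h0
  refine ⟨hfirst, ?_⟩
  /- ── the `H_m`-centre at time `r` and the entropy comparison ── -/
  obtain ⟨z₁, hvar⟩ := hflow.exists_lintegral_edist_sq_heatKernelMeasure_le hh hR hm0 hrI htI hrt.le x
  have hRs : ∀ z : M, Rmin ≤ (h s).scalarCurvatureWith (cov s) z := hRmin s ⟨le_rfl, hst.le⟩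
  set L : ℝ := Real.sqrt ((m : ℝ) / (2 * (r - s)) - Rmin) with hL
  have hL0 : 0 ≤ L := Real.sqrt_nonneg _
  set V : ℝ := Hm * (t - r) with hV
  have hV0 : 0 ≤ V := by rw [hV, htr]; exact mul_nonneg hHm0.le (by linarith only [hτ])
  have hEC : ∀ w : M, N - pointedNashEntropy h (fun r' v ↦ hflow.heatKernelFn hh hR r w (v, r')) m r s
      ≤ L * (Real.sqrt V + ((h r).edist (hR r) z₁ w).toReal) := fun w ↦
    kernelNashEntropy_sub_le_of_lintegral_edist_sq_le hflow hh hR hm has hsr hrt.le htT hRs x z₁ hV0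
      hvar w
  -- scale-free bounds: `L √τ ≤ √(m + Λ)`, `L √V ≤ E₁`, `L² τ ≤ m + Λ`, `2 L √(2 H (t − r)) ≤ 2 E₁`
  have hLτ : L * Real.sqrt τ ≤ Real.sqrt ((m : ℝ) + Λ) := by
    refine sqrt_mul_sqrt_le_sqrt_of_le_div hτ ?_
    have h2 : (m : ℝ) / (2 * (r - s)) = (m : ℝ) / τ := by rw [hrs]; ring
    have hRmτ : -Rmin ≤ Λ / τ := by rw [le_div_iff₀ hτ]; exact hRΛ
    rw [h2, add_div]; linarith only [hRmτ]
  have hLsqτ : L ^ 2 * τ ≤ (m : ℝ) + Λ := by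
    have h1' : L ^ 2 * τ = (L * Real.sqrt τ) ^ 2 := by rw [mul_pow, Real.sq_sqrt hτ.le]
    rw [h1', ← Real.sq_sqrt hmΛ]
    exact pow_le_pow_left₀ (mul_nonneg hL0 (Real.sqrt_nonneg _)) hLτ 2
  have hLV : L * Real.sqrt V ≤ E₁ := by
    have h1' : Real.sqrt V ≤ Real.sqrt τ * Real.sqrt Hm := by
      rw [hV, htr, ← Real.sqrt_mul hτ.le]
      exact Real.sqrt_le_sqrt (by nlinarith only [hτ, hHm0])
    calc L * Real.sqrt V ≤ L * (Real.sqrt τ * Real.sqrt Hm) := mul_le_mul_of_nonneg_left h1' hL0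
      _ = (L * Real.sqrt τ) * Real.sqrt Hm := by ring
      _ ≤ Real.sqrt ((m : ℝ) + Λ) * Real.sqrt Hm :=
          mul_le_mul_of_nonneg_right hLτ (Real.sqrt_nonneg _)
  have hLH : 2 * L * Real.sqrt (2 * (Hm * (t - r))) ≤ 2 * E₁ := by
    have e : 2 * (Hm * (t - r)) = τ * Hm := by rw [htr]; ring
    rw [e, Real.sqrt_mul hτ.le]
    calc 2 * L * (Real.sqrt τ * Real.sqrt Hm) = 2 * ((L * Real.sqrt τ) * Real.sqrt Hm) := by ring
      _ ≤ 2 * (Real.sqrt ((m : ℝ) + Λ) * Real.sqrt Hm) := by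
          refine mul_le_mul_of_nonneg_left ?_ (by norm_num)
          exact mul_le_mul_of_nonneg_right hLτ (Real.sqrt_nonneg _)
  /- ── `u = K(·,r;y,s)`: pointwise bound from Thm. 7.1 on `[s, r]` and the comparison ── -/
  set u : M → ℝ := fun w ↦ hflow.heatKernelFn hh hR r w (y, s) with hu
  have hupos : ∀ w, 0 < u w := fun w ↦ hflow.heatKernelFn_pos hh hR hrT w ⟨mem_univ _, has, hsr⟩
  have huc : Continuous u := hflow.continuous_heatKernelFn_basePoint_slice hh hR hrT ⟨has, hsr⟩
  have hRmin' : ∀ r' ∈ Icc s r, ∀ z : M, Rmin ≤ (h r').scalarCurvatureWith (cov r') z :=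
    fun r' hr' z ↦ hRmin r' ⟨hr'.1, hr'.2.trans hrt.le⟩ z
  have hRΛ' : -Rmin * (r - s) ≤ Λ := by
    rw [hrs]
    rcases le_or_gt 0 Rmin with h0 | h0
    · have : -Rmin * (τ / 2) ≤ 0 := by nlinarith only [h0, hτ]
      linarith only [this, hΛ]
    · have : -Rmin * (τ / 2) ≤ -Rmin * τ := by nlinarith only [h0, hτ]
      linarith only [this, hRΛ]
  have hrspow : 0 ≤ (r - s) ^ (-(m : ℝ) / 2) := Real.rpow_nonneg (by rw [hrs]; linarith only [hτ]) _
  set A₀ : ℝ := C₇ * (τ / 2) ^ (-(m : ℝ) / 2) * Real.exp (-N) * Real.exp E₁ with hA₀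
  have hubound : ∀ w, u w ≤ A₀ * Real.exp (L * ((h r).edist (hR r) z₁ w).toReal) := by
    intro w
    have h71 := H7 hflow hh hR has hsr (hrt.trans htT) hRmin' hRΛ' w y
    have hcmp : -(pointedNashEntropy h (fun r' v ↦ hflow.heatKernelFn hh hR r w (v, r')) m r s) ≤
        -N + E₁ + L * ((h r).edist (hR r) z₁ w).toReal := by
      have h' := hEC w
      rw [mul_add] at h'
      linarith only [h', hLV]
    calc u w ≤ C₇ * (r - s) ^ (-(m : ℝ) / 2) *
          Real.exp (-(pointedNashEntropy h (fun r' v ↦ hflow.heatKernelFn hh hR r w (v, r')) m r s)) :=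
          h71
      _ ≤ C₇ * (r - s) ^ (-(m : ℝ) / 2) *
          Real.exp (-N + E₁ + L * ((h r).edist (hR r) z₁ w).toReal) :=
          mul_le_mul_of_nonneg_left (Real.exp_le_exp.2 hcmp) (mul_nonneg hC₇.le hrspow)
      _ = A₀ * Real.exp (L * ((h r).edist (hR r) z₁ w).toReal) := by
          rw [hA₀, hrs, Real.exp_add, Real.exp_add]; ring
  /- ── `∫ u² dν ≤ D₂² P²` ── -/
  set ν : Measure M := heatKernelMeasure hh hR t x r with hν
  haveI : IsProbabilityMeasure ν := by rw [hν]; infer_instance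
  have hdcont : Continuous fun w ↦ (h r).edist (hR r) z₁ w :=
    ((h r).continuous_edist (hR r)).comp (.prodMk_right z₁)
  have hdfin : ∀ w, (h r).edist (hR r) z₁ w ≠ ⊤ := fun w ↦
    PseudoRiemannianMetric.edist_ne_top (hR r) z₁ w
  set dd : M → ℝ := fun w ↦ ((h r).edist (hR r) z₁ w).toReal with hdd
  have hddc : Continuous dd := continuous_iff_continuousAt.2 fun w ↦
    (ENNReal.tendsto_toReal (hdfin w)).comp (hdcont.tendsto w)
  have hexp := integral_exp_mul_edist_heatKernelMeasure_le hflow hh hR hm0 har hrt htT.le x z₁ hvar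
    (κ := 2 * L) (mul_nonneg zero_le_two hL0)
  have hexp' : ∫ w, Real.exp ((2 * L) * dd w) ∂ν ≤ 3 * Real.exp (16 * ((m : ℝ) + Λ) + 2 * E₁) := by
    refine hexp.trans ?_
    refine mul_le_mul_of_nonneg_left (Real.exp_le_exp.2 ?_) (by norm_num)
    have e1 : 8 * (2 * L) ^ 2 * (t - r) = 16 * (L ^ 2 * τ) := by rw [htr]; ring
    have e2 : (2 * L) * Real.sqrt (2 * ((((m : ℝ) - 1) * Real.pi ^ 2 / 2 + 4) * (t - r))) =
        2 * L * Real.sqrt (2 * (Hm * (t - r))) := by rw [hHm]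
    rw [e1, e2]
    have := mul_le_mul_of_nonneg_left hLsqτ (by norm_num : (0 : ℝ) ≤ 16)
    linarith only [this, hLH]
  have hu2 : ∫ w, u w ^ 2 ∂ν ≤ (D₂ * P) ^ 2 := by
    -- pointwise `u² ≤ A₀² e^{2L d}`
    have hpt : ∀ w, u w ^ 2 ≤ A₀ ^ 2 * Real.exp ((2 * L) * dd w) := by
      intro w
      have h2' : u w ^ 2 ≤ (A₀ * Real.exp (L * dd w)) ^ 2 :=
        pow_le_pow_left₀ (hupos w).le (hubound w) 2
      calc u w ^ 2 ≤ (A₀ * Real.exp (L * dd w)) ^ 2 := h2'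
        _ = A₀ ^ 2 * Real.exp ((2 * L) * dd w) := by
            rw [mul_pow, ← Real.exp_nat_mul]
            congr 2
            push_cast; ring
    have hmaj_c : Continuous fun w ↦ A₀ ^ 2 * Real.exp ((2 * L) * dd w) :=
      continuous_const.mul (Real.continuous_exp.comp (continuous_const.mul hddc))
    have hmaj_i : Integrable (fun w ↦ A₀ ^ 2 * Real.exp ((2 * L) * dd w)) ν :=
      hmaj_c.integrable_of_hasCompactSupport (HasCompactSupport.of_compactSpace _)
    have hu2_i : Integrable (fun w ↦ u w ^ 2) ν :=
      (huc.pow 2).integrable_of_hasCompactSupport (HasCompactSupport.of_compactSpace _)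
    have h1' : ∫ w, u w ^ 2 ∂ν ≤ ∫ w, A₀ ^ 2 * Real.exp ((2 * L) * dd w) ∂ν :=
      integral_mono hu2_i hmaj_i hpt
    have h2' : ∫ w, A₀ ^ 2 * Real.exp ((2 * L) * dd w) ∂ν ≤
        A₀ ^ 2 * (3 * Real.exp (16 * ((m : ℝ) + Λ) + 2 * E₁)) := by
      rw [integral_const_mul]
      exact mul_le_mul_of_nonneg_left hexp' (sq_nonneg _)
    -- `A₀² · 3 e^{16(m+Λ)+2E₁} = (D₂ P)²`
    have hhalf : (τ / 2) ^ (-(m : ℝ) / 2) = (2 : ℝ) ^ ((m : ℝ) / 2) * τ ^ (-(m : ℝ) / 2) := by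
      rw [Real.div_rpow hτ.le (by norm_num), neg_div, Real.rpow_neg (by norm_num : (0:ℝ) ≤ 2),
        div_eq_mul_inv, inv_inv, mul_comm]
    have h2m : ((2 : ℝ) ^ ((m : ℝ) / 2)) ^ 2 = 2 ^ m := by
      rw [← Real.rpow_natCast ((2 : ℝ) ^ ((m : ℝ) / 2)) 2, ← Real.rpow_mul (by norm_num)]
      norm_num
    have hA₀sq : A₀ ^ 2 * (3 * Real.exp (16 * ((m : ℝ) + Λ) + 2 * E₁)) = (D₂ * P) ^ 2 := by
      have hD₂sq : D₂ ^ 2 = C₇ ^ 2 * (3 * 2 ^ m * Real.exp (4 * E₁ + 16 * ((m : ℝ) + Λ))) := by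
        rw [hD₂, mul_pow, Real.sq_sqrt (by positivity)]
      have e4 : Real.exp (4 * E₁ + 16 * ((m : ℝ) + Λ)) =
          Real.exp E₁ ^ 2 * Real.exp (16 * ((m : ℝ) + Λ) + 2 * E₁) := by
        rw [sq, ← Real.exp_add, ← Real.exp_add]; ring_nf
      have hA₀' : A₀ = C₇ * (2 : ℝ) ^ ((m : ℝ) / 2) * τ ^ (-(m : ℝ) / 2) * Real.exp (-N) *
          Real.exp E₁ := by rw [hA₀, hhalf]; ring
      have hDP : (D₂ * P) ^ 2 =
          C₇ ^ 2 * (3 * 2 ^ m * Real.exp (4 * E₁ + 16 * ((m : ℝ) + Λ))) * P ^ 2 := by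
        rw [mul_pow, hD₂sq]
      rw [hDP, hA₀', hP, e4]
      simp only [mul_pow]
      rw [h2m]
      ring
    calc ∫ w, u w ^ 2 ∂ν ≤ A₀ ^ 2 * (3 * Real.exp (16 * ((m : ℝ) + Λ) + 2 * E₁)) := h1'.trans h2'
      _ = (D₂ * P) ^ 2 := hA₀sq
  /- ── the score `q = ∂K/K` at time `r`, its boundedness, and `∂K = ∫ q u dν` ── -/
  set K₀ : M → ℝ := fun w ↦ hflow.heatKernelFn hh hR t x (w, r) with hK₀
  set Kd : M → ℝ := fun w ↦ deriv (fun σ ↦ hflow.heatKernelFn hh hR t (γ σ) (w, r)) 0 with hKd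
  have hK₀c : Continuous K₀ := hflow.continuous_heatKernelFn_slice hh hR ht x ⟨har, hrt⟩
  have hK₀pos : ∀ w, 0 < K₀ w := fun w ↦ hflow.heatKernelFn_pos hh hR ht x ⟨mem_univ _, har, hrt⟩
  obtain ⟨k₀, hk₀pos, hk₀⟩ : ∃ k₀ : ℝ, 0 < k₀ ∧ ∀ w, k₀ ≤ K₀ w := by
    rcases isEmpty_or_nonempty M with hM | hM
    · exact ⟨1, one_pos, fun w ↦ (IsEmpty.false w).elim⟩
    · obtain ⟨w₀, -, hw₀⟩ := isCompact_univ.exists_isMinOn univ_nonempty hK₀c.continuousOn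
      exact ⟨K₀ w₀, hK₀pos w₀, fun w ↦ hw₀ (mem_univ w)⟩
  set q : M → ℝ := fun w ↦ Kd w / K₀ w with hq
  have hKdm : Measurable Kd := hflow.measurable_deriv_heatKernelFn_curve hh hR har hrt htT hγ
  have hqm : Measurable q := hKdm.div hK₀c.measurable
  obtain ⟨Bd, hBd⟩ := hflow.exists_abs_deriv_heatKernelFn_curve_le hh hR har hrt htT hγ
  have hBd0 : 0 ≤ Bd := (abs_nonneg _).trans (hBd x)
  have hqb : ∃ B : ℝ, ∀ w, |q w| ≤ B := by
    refine ⟨Bd / k₀, fun w ↦ ?_⟩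
    show |Kd w / K₀ w| ≤ Bd / k₀
    rw [abs_div, abs_of_pos (hK₀pos w)]
    exact div_le_div₀ hBd0 (hBd w) hk₀pos (hk₀ w)
  have hnqb : ∃ B : ℝ, ∀ w, |(-q) w| ≤ B := by
    obtain ⟨B, hB⟩ := hqb
    exact ⟨B, fun w ↦ by rw [Pi.neg_apply, abs_neg]; exact hB w⟩
  obtain ⟨Bu, hBu⟩ : ∃ B : ℝ, ∀ w, |u w| ≤ B := by
    rcases isEmpty_or_nonempty M with hM | hM
    · exact ⟨1, fun w ↦ (IsEmpty.false w).elim⟩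
    · obtain ⟨w₀, -, hw₀⟩ := isCompact_univ.exists_isMaxOn univ_nonempty huc.continuousOn
      exact ⟨u w₀, fun w ↦ by rw [abs_of_pos (hupos w)]; exact hw₀ (mem_univ w)⟩
  -- `K = ∫ u dν` (reproduction) and `∂K = ∫ q u dν` (differentiated semigroup formula)
  have hKeq : K = ∫ w, u w ∂ν := hflow.heatKernelFn_reproduction hh hR har hrt htT.le x ⟨has, hsr⟩ y
  have hptid : ∀ w, q w * u w * K₀ w = Kd w * u w := by
    intro w
    have hne : K₀ w ≠ 0 := (hK₀pos w).ne'
    simp only [hq]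
    field_simp
  have hK'eq : deriv (fun σ ↦ hflow.heatKernelFn hh hR t (γ σ) (y, s)) 0 = ∫ w, q w * u w ∂ν := by
    rw [deriv_heatKernelFn_curve_eq_integral_mul hflow hh hR has hsr hrt htT hγ y 0, hν,
      hflow.integral_heatKernelMeasure_eq_integral_mul_heatKernelFn hh hR ht x ⟨har, hrt⟩]
    refine integral_congr_ae (Eventually.of_forall fun w ↦ ?_)
    exact (hptid w).symm
  /- ── the localized integral bound at scale `t − r = τ/2` ── -/
  have hloc : ∀ Y : Set M, MeasurableSet Y →
      ∫ w in Y, q w ^ 2 ∂ν ≤ (2 * Cloc / τ) * ν.real Y * (1 - Real.log (ν.real Y)) := by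
    intro Y hY
    have hl : (t - r) * ∫ w in Y, q w ^ 2 ∂ν ≤
        Cloc * ν.real Y * (1 - Real.log (ν.real Y)) :=
      HLoc hflow hh hR har hrt htT hγ h1 hY
    have htr0 : 0 < t - r := by rw [htr]; linarith only [hτ]
    have hτne : τ ≠ 0 := hτ.ne'
    have e : 2 * Cloc / τ = Cloc / (t - r) := by
      rw [htr]; field_simp
    rw [e, div_mul_eq_mul_div, div_mul_eq_mul_div, le_div_iff₀ htr0]
    calc (∫ w in Y, q w ^ 2 ∂ν) * (t - r) = (t - r) * ∫ w in Y, q w ^ 2 ∂ν := mul_comm _ _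
      _ ≤ Cloc * ν.real Y * (1 - Real.log (ν.real Y)) := hl
  have hloc' : ∀ Y : Set M, MeasurableSet Y →
      ∫ w in Y, (-q) w ^ 2 ∂ν ≤ (2 * Cloc / τ) * ν.real Y * (1 - Real.log (ν.real Y)) := by
    intro Y hY
    have e : ∫ w in Y, (-q) w ^ 2 ∂ν = ∫ w in Y, q w ^ 2 ∂ν :=
      integral_congr_ae (Eventually.of_forall fun w ↦ by simp only [Pi.neg_apply, neg_sq])
    rw [e]; exact hloc Y hY
  /- ── the level `a₀` and the two splittings ── -/
  have hBP : 0 < B₀ * P := mul_pos hB₀0 hP0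
  have hKBPpos : 0 < K / (B₀ * P) := div_pos hKpos hBP
  set a₀ : ℝ := (K / (B₀ * P)) ^ 2 with ha₀
  have ha₀pos : 0 < a₀ := pow_pos hKBPpos 2
  have hKBP : K / (B₀ * P) ≤ 1 / 2 := by
    rw [div_le_iff₀ hBP, hB₀]; linarith only [hK7]
  have ha₀le : a₀ ≤ 1 := by
    have h' : (K / (B₀ * P)) ^ 2 ≤ (1 / 2) ^ 2 := pow_le_pow_left₀ hKBPpos.le hKBP 2
    rw [ha₀]; linarith only [h']
  have hsqa : Real.sqrt a₀ = K / (B₀ * P) := by rw [ha₀, Real.sqrt_sq hKBPpos.le]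
  have hcL : 0 < 2 * Cloc / τ := div_pos (by linarith only [hCloc0]) hτ
  have hUa : Real.sqrt a₀ * (D₂ * P) = (D₂ / B₀) * K := by
    rw [hsqa]
    field_simp
  have hDP0 : 0 ≤ D₂ * P := mul_nonneg hD₂0 hP0.le
  have hsplit : ∀ φ : M → ℝ, Measurable φ → (∃ B : ℝ, ∀ w, |φ w| ≤ B) →
      (∀ Y : Set M, MeasurableSet Y →
        ∫ w in Y, φ w ^ 2 ∂ν ≤ (2 * Cloc / τ) * ν.real Y * (1 - Real.log (ν.real Y))) →
      ∫ w, φ w * u w ∂ν ≤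
        Real.sqrt ((2 * Cloc / τ) * (1 - Real.log a₀)) * ((1 + D₂ / B₀) * K) := by
    intro φ hφm hφb hφloc
    have hmain := integral_mul_le_sqrt_mul_of_local_sq_bound ν hφm hφb huc.measurable ⟨Bu, hBu⟩
      (fun w ↦ (hupos w).le) hcL hφloc hDP0 hu2 ha₀pos ha₀le
    rw [hUa, ← hKeq] at hmain
    calc ∫ w, φ w * u w ∂ν
        ≤ Real.sqrt ((2 * Cloc / τ) * (1 - Real.log a₀)) * (D₂ / B₀ * K + K) := hmain
      _ = Real.sqrt ((2 * Cloc / τ) * (1 - Real.log a₀)) * ((1 + D₂ / B₀) * K) := by ring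
  have hup := hsplit q hqm hqb hloc
  have hdown := hsplit (-q) hqm.neg hnqb hloc'
  have hdown' : -(∫ w, q w * u w ∂ν) ≤
      Real.sqrt ((2 * Cloc / τ) * (1 - Real.log a₀)) * ((1 + D₂ / B₀) * K) := by
    rw [← integral_neg]
    refine le_of_eq_of_le ?_ hdown
    refine integral_congr_ae (Eventually.of_forall fun w ↦ ?_)
    simp only [Pi.neg_apply, neg_mul]
  have habs : |∫ w, q w * u w ∂ν| ≤
      Real.sqrt ((2 * Cloc / τ) * (1 - Real.log a₀)) * ((1 + D₂ / B₀) * K) :=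
    abs_le.2 ⟨by linarith only [hdown'], hup⟩
  /- ── final algebra: `1 − log a₀ = 2 log (C₀ P / K)` ── -/
  have hlogid : 1 - Real.log a₀ =
      2 * Real.log (C₀ * τ ^ (-(m : ℝ) / 2) * Real.exp (-N) / K) := by
    have hKne : K ≠ 0 := hKpos.ne'
    have e1 : C₀ * τ ^ (-(m : ℝ) / 2) * Real.exp (-N) / K =
        Real.sqrt (Real.exp 1) * ((B₀ * P) / K) := by
      rw [hC₀, hP]; field_simp
    rw [e1, Real.log_mul (by positivity) (div_pos hBP hKpos).ne', Real.log_sqrt (Real.exp_pos 1).le,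
      Real.log_exp, ha₀, Real.log_pow, Real.log_div hKne hBP.ne', Real.log_div hBP.ne' hKne]
    push_cast
    ring
  have hsqτ : (Real.sqrt τ)⁻¹ = τ ^ (-(1 : ℝ) / 2) := by
    rw [Real.sqrt_eq_rpow, ← Real.rpow_neg hτ.le]
    norm_num
  have hsqrt_id : Real.sqrt ((2 * Cloc / τ) * (1 - Real.log a₀)) =
      2 * Real.sqrt Cloc * τ ^ (-(1 : ℝ) / 2) *
        Real.sqrt (Real.log (C₀ * τ ^ (-(m : ℝ) / 2) * Real.exp (-N) / K)) := by
    rw [hlogid]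
    have e2 : (2 * Cloc / τ) * (2 * Real.log (C₀ * τ ^ (-(m : ℝ) / 2) * Real.exp (-N) / K)) =
        (4 * τ⁻¹) * (Cloc * Real.log (C₀ * τ ^ (-(m : ℝ) / 2) * Real.exp (-N) / K)) := by ring
    have h4 : Real.sqrt 4 = 2 := by
      rw [show (4 : ℝ) = 2 ^ 2 by norm_num, Real.sqrt_sq (by norm_num)]
    rw [e2, Real.sqrt_mul (mul_nonneg (by norm_num) (inv_pos.2 hτ).le), Real.sqrt_mul hCloc0.le,
      Real.sqrt_mul (by norm_num : (0:ℝ) ≤ 4), h4, Real.sqrt_inv, hsqτ]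
    ring
  rw [hK'eq]
  refine habs.trans (le_of_eq ?_)
  rw [hsqrt_id, hC]
  ring

end GradientBound

end Literature.Geometry.Riemannian

end
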